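import Summits.BirchSwinnertonDyer.BirchSwinnertonDyer.Theorems.ByReductionTypeAtTwoOrdEisensteinHalfShaCurrency
import Literature.Uncategorized.OrdPublishedInputsAtTwo
import HarnessLib

/-!
# The Eisenstein half of the `2`-adic main conjecture in `Ш`-currency, IV: the crux constant by name
# (route ByReductionTypeAtTwo / TwoAdicConverse, crux `OrdEisensteinHalfAtTwo`,
# item stmt-BirchSwinnertonDyer-19272; seat bsd-2adic-ord-3, GEN 2)

HONEST FRAMING (cell `bsd-2adic`, HUMAN RULINGS D-0036/D-0074): THEOREMS ONLY; REDUCTIONS, not closings —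
every non-PUB input is a displayed hypothesis; nothing asserted; no definition; no named fact.

WHAT IS PROVED. Granted the support item `OrdPublishedInputsAtTwo` (PUB conjunction: modularity, GZK, Kato
17.4 (1)(2) AT `2`, Greenberg 4.1 parity-free — `Literature.Uncategorized.OrdPublishedInputsAtTwo`):
* `ordEisensteinHalfAtTwo_of_ordKatoHalfAtTwo_of_missingLowerBoundAt`: the crux constant
  `Theorems.OrdHalvesAtTwo.OrdEisensteinHalfAtTwo` (= the route decls `Theses.ByReductionTypeAtTwo.OrdEisensteinHalfAtTwo`,
  `Theses.TwoAdicConverse.OrdEisensteinHalfAtTwo`, same text) follows from the sibling crux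
  `Theorems.OrdHalvesAtTwo.OrdKatoHalfAtTwo` + ONE descent inequality `MissingLowerBoundAt W 2` per non-CM
  rank-`0` good-ordinary curve + the crux's own rank-`≥ 1` part (displayed VERBATIM: neither route consumes
  it — the formula route lives at analytic rank `0`, the converse route on the finite-Selmer locus);
* `ordEisensteinHalfAtTwo_of_mu_zero_sha_certificates`: the same with the Kato half replaced by its
  `μ = 0` certificate form {Néron integrality, `μ(X) = 0` for the cyclotomic data};
* `eisenstein_rankZero_iff_missingLowerBoundAt_rankZero_of_ordKatoHalfAtTwo`: granted `OrdKatoHalfAtTwo`,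
  the rank-`0` part of the crux ⟺ the descent schema (`∀` rank-`0` curves, `MissingLowerBoundAt W 2`) ⟺
  the parent `GoodOrdinaryRankZeroAtTwo` unfolded (`∀` rank-`0` curves, `BSDp W 2`) — complementing the
  landed `KatoHalfPinchGlue.goodOrdinaryRankZeroAtTwo_iff_eisenstein_rankZero_of_ordKatoHalfAtTwo`.

READING FOR THE PLANNER. On the formula route's domain, `OrdEisensteinHalfAtTwo` minus `OrdKatoHalfAtTwo`
is EXACTLY the per-curve descent inequality `ord₂ #Ш_an(E) ≤ ord₂ #Ш(E)[2^∞]`; the crux AS TYPED is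
rank-free and its rank-`≥ 1` part is idle for both routes.

References: K. Kato, Astérisque 295 (2004), Thm. 17.4; R. Greenberg, LNM 1716 (1999), Thm. 4.1;
R. L. Miller, LMS J. Comput. Math. 14 (2011), Def. 1.1.
-/

set_option autoImplicit false

noncomputable section

open scoped Classical MatrixGroups ModularForm

open CongruenceSubgroup WeierstrassCurve Literature.NumberTheory.EllipticCurves
  Literature.NumberTheory.EllipticCurves.ModularForms Literature.NumberTheory.EllipticCurves.Rank1Residual
  Literature.NumberTheory.EllipticCurves.Rank1Residual.Typed
  Summit.BirchSwinnertonDyer.Rank1Residual.X1.MuLambda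
  Summit.BirchSwinnertonDyer.Rank1Residual.X1.MuPart
  Summit.BirchSwinnertonDyer.Rank1Residual.X1.ParitySqueeze

namespace Summit.BirchSwinnertonDyer.BirchSwinnertonDyer.Theorems.EisensteinShaCurrency

/-! ## §5 The ∀-closed readings: the crux constant by name -/

section Crux

open Summit.BirchSwinnertonDyer.Rank1Residual Summit.BirchSwinnertonDyer.Rank1Residual.X5
  Summit.BirchSwinnertonDyer.BirchSwinnertonDyer.Theorems.Rank1ResidualX1Defs

/-- **`OrdEisensteinHalfAtTwo` ⟸ `OrdKatoHalfAtTwo` + one descent inequality per rank-`0` curve +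
its own rank-`≥ 1` part.** Granted the support item `OrdPublishedInputsAtTwo` (PUB: modularity, GZK,
Kato 17.4 (1)(2) AT `2`, Greenberg 4.1 parity-free), the sibling crux `OrdKatoHalfAtTwo` (the ∀-closed
Kato half on non-CM rank-`0` good-ordinary curves), the per-curve descent inequality
`MissingLowerBoundAt W 2` on the same curves, and the Eisenstein half on the rank-`≥ 1` good-ordinary
non-CM curves (displayed verbatim — neither route consumes it: the formula route lives at analytic
rank `0`, the converse route on the finite-Selmer locus), the crux constant
`Theorems.OrdHalvesAtTwo.OrdEisensteinHalfAtTwo` (= both route decls) holds. A REDUCTION, not a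
closing. [cite: Kato2004Asterisque, Thm. 17.4 (1)(2) (p. 273)] [cite: GreenbergLNM1716, Thm. 4.1 (p. 102)] -/
theorem ordEisensteinHalfAtTwo_of_ordKatoHalfAtTwo_of_missingLowerBoundAt
    (hpub : Literature.Uncategorized.OrdPublishedInputsAtTwo)
    (hK : Summit.BirchSwinnertonDyer.BirchSwinnertonDyer.Theorems.OrdHalvesAtTwo.OrdKatoHalfAtTwo)
    (hsha : ∀ (W : WeierstrassCurve ℚ) [W.IsElliptic] [W.IsGloballyMinimal], ¬ W.HasCM →
      W.analyticRank = 0 → GoodOrd W 2 → MissingLowerBoundAt W 2)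
    (hpos : ∀ (W : WeierstrassCurve ℚ) [W.IsElliptic] [W.IsGloballyMinimal], ¬ W.HasCM →
      GoodOrd W 2 → W.analyticRank ≠ 0 → O1.MainConjectureEisensteinDivisibilityAtTwo W) :
    Summit.BirchSwinnertonDyer.BirchSwinnertonDyer.Theorems.OrdHalvesAtTwo.OrdEisensteinHalfAtTwo := by
  obtain ⟨hmod, hGZK, h17, hGr⟩ := hpub
  intro W _ _ hcm hgo
  by_cases hr : W.analyticRank = 0
  · exact eisensteinAtTwo_of_katoHalf_of_missingLowerBoundAt W (h17 W)
      (O1.twoAdicEulerCharRankZero_zero_of_greenberg W hGr) hGZK hmod hgo hr (hK W hcm hr hgo)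
      (hsha W hcm hr hgo)
  · exact hpos W hcm hgo hr

/-- **Certificate form, ∀-closed.** PUB + per rank-`0` curve {Néron integrality `hper₀`, `μ(X) = 0`
for the cyclotomic data, `MissingLowerBoundAt W 2`} + the rank-`≥ 1` part displayed ⇒ the crux
constant. (The `μ = 0` certificate is the whole content of `OrdKatoHalfAtTwo` on the `μ_an = 0`
classes; the descent inequality is the whole REMAINING content of `OrdEisensteinHalfAtTwo` there.)
[cite: Kato2004Asterisque, Thm. 17.4 (1)(2) (p. 273)] [cite: GreenbergLNM1716, Thm. 4.1 (p. 102) and Prop. 5.14 (p. 121)] -/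
theorem ordEisensteinHalfAtTwo_of_mu_zero_sha_certificates
    (hpub : Literature.Uncategorized.OrdPublishedInputsAtTwo)
    (h0 : ∀ (W : WeierstrassCurve ℚ) [W.IsElliptic] [W.IsGloballyMinimal], ¬ W.HasCM →
      W.analyticRank = 0 → GoodOrd W 2 →
      (∀ [NeZero (W.conductorNorm ℤ)] (f : CuspForm (Gamma0 (W.conductorNorm ℤ)) 2),
        IsNewformOf W f → ∀ ϖ : ℚ, (ϖ : ℝ) * W.realPeriodRat = plusPeriod f → 0 ≤ padicValRat 2 ϖ) ∧
      (∀ (κ : ZpExtension ℚ 2) (γ : Field.absoluteGaloisGroup ℚ), κ.IsCyclotomic →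
        κ.IsTopGenerator γ → IsCyclotomicVariable 2 γ → ∀ D : W.SelmerDualData κ γ, D.mu = 0) ∧
      MissingLowerBoundAt W 2)
    (hpos : ∀ (W : WeierstrassCurve ℚ) [W.IsElliptic] [W.IsGloballyMinimal], ¬ W.HasCM →
      GoodOrd W 2 → W.analyticRank ≠ 0 → O1.MainConjectureEisensteinDivisibilityAtTwo W) :
    Summit.BirchSwinnertonDyer.BirchSwinnertonDyer.Theorems.OrdHalvesAtTwo.OrdEisensteinHalfAtTwo := by
  obtain ⟨hmod, hGZK, h17, hGr⟩ := hpub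
  intro W _ _ hcm hgo
  by_cases hr : W.analyticRank = 0
  · obtain ⟨hper₀, hμ, hsha⟩ := h0 W hcm hr hgo
    exact eisensteinAtTwo_of_mu_eq_zero_of_missingLowerBoundAt W (h17 W) hper₀
      (O1.twoAdicEulerCharRankZero_zero_of_greenberg W hGr) hGZK hmod hgo hr hμ hsha
  · exact hpos W hcm hgo hr

/-- **On the formula route's domain the two readings of the residue coincide.** Granted
`OrdPublishedInputsAtTwo` and `OrdKatoHalfAtTwo`: the rank-`0` part of the Eisenstein crux
(`∀` non-CM rank-`0` good-ordinary `W`, `X5.O1.MainConjectureEisensteinDivisibilityAtTwo W`) holds IFF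
the descent schema (`∀` such `W`, `MissingLowerBoundAt W 2`) holds IFF the parent
`GoodOrdinaryRankZeroAtTwo` unfolded (`∀` such `W`, `BSDp W 2`) holds. Complements the landed
`KatoHalfPinchGlue.goodOrdinaryRankZeroAtTwo_iff_eisenstein_rankZero_of_ordKatoHalfAtTwo`.
[cite: Kato2004Asterisque, Thm. 17.4 (1)(2) (p. 273)] [cite: Miller2011LMS, Def. 1.1] -/
theorem eisenstein_rankZero_iff_missingLowerBoundAt_rankZero_of_ordKatoHalfAtTwo
    (hpub : Literature.Uncategorized.OrdPublishedInputsAtTwo)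
    (hK : Summit.BirchSwinnertonDyer.BirchSwinnertonDyer.Theorems.OrdHalvesAtTwo.OrdKatoHalfAtTwo) :
    ((∀ (W : WeierstrassCurve ℚ) [W.IsElliptic] [W.IsGloballyMinimal], ¬ W.HasCM →
        W.analyticRank = 0 → GoodOrd W 2 → O1.MainConjectureEisensteinDivisibilityAtTwo W) ↔
      (∀ (W : WeierstrassCurve ℚ) [W.IsElliptic] [W.IsGloballyMinimal], ¬ W.HasCM →
        W.analyticRank = 0 → GoodOrd W 2 → MissingLowerBoundAt W 2)) ∧
    ((∀ (W : WeierstrassCurve ℚ) [W.IsElliptic] [W.IsGloballyMinimal], ¬ W.HasCM →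
        W.analyticRank = 0 → GoodOrd W 2 → MissingLowerBoundAt W 2) ↔
      (∀ (W : WeierstrassCurve ℚ) [W.IsElliptic] [W.IsGloballyMinimal], ¬ W.HasCM →
        W.analyticRank = 0 → GoodOrd W 2 → BSDp W 2)) := by
  obtain ⟨hmod, hGZK, h17, hGr⟩ := hpub
  refine ⟨⟨fun h W _ _ hcm hr hgo => ?_, fun h W _ _ hcm hr hgo => ?_⟩,
    ⟨fun h W _ _ hcm hr hgo => ?_, fun h W _ _ hcm hr hgo => ?_⟩⟩
  · exact (eisensteinAtTwo_iff_missingLowerBoundAt_of_katoHalf W (h17 W)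
      (O1.twoAdicEulerCharRankZero_zero_of_greenberg W hGr) hGZK hmod hgo hr (hK W hcm hr hgo)).mp
      (h W hcm hr hgo)
  · exact (eisensteinAtTwo_iff_missingLowerBoundAt_of_katoHalf W (h17 W)
      (O1.twoAdicEulerCharRankZero_zero_of_greenberg W hGr) hGZK hmod hgo hr (hK W hcm hr hgo)).mpr
      (h W hcm hr hgo)
  · exact (bsdp_two_iff_missingLowerBoundAt_of_katoHalf W (h17 W)
      (O1.twoAdicEulerCharRankZero_zero_of_greenberg W hGr) hGZK hmod hgo hr (hK W hcm hr hgo)).mpr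
      (h W hcm hr hgo)
  · exact (bsdp_two_iff_missingLowerBoundAt_of_katoHalf W (h17 W)
      (O1.twoAdicEulerCharRankZero_zero_of_greenberg W hGr) hGZK hmod hgo hr (hK W hcm hr hgo)).mp
      (h W hcm hr hgo)

end Crux

end Summit.BirchSwinnertonDyer.BirchSwinnertonDyer.Theorems.EisensteinShaCurrency

end
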